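import Summits.CriticalPhenomena.PercolationContinuityZ3.Theorems.Transplant.GrigorchukLevelTransitive
import Summits.CriticalPhenomena.PercolationContinuityZ3.Theorems.Transplant.GrigorchukLamplighterStandardGensNoGo
import Mathlib.GroupTheory.Subgroup.Centralizer
import Mathlib.GroupTheory.Index
import Mathlib.Data.Fintype.Pigeonhole
import HarnessLib

/-!
# SCOPE RECORD: `Γ₂ = ℤ ≀_X 𝔊` has TRIVIAL FC-CENTRE — every non-trivial element has a centraliser of infinite index — so the covering route («AutEndStateFC» /
# «AutEndStateFCCayleyVFC»: an element with a non-trivial character value commuting with a finite-index subgroup) has NO input built from subgroups of `Γ₂`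

builds on p205010 (kernel theorem, internal audit signed; external expert review pending) — nothing in this file uses p205010; pure group theory, no percolation
statement, no node touched.  Lane `prim-bschramm`, seat `prim-bschramm-p3` gen 35 (DESIGN OWNER; `run/shared/lean/prim/bschramm/P3-NILPOTENT.md` §28; lead g25 GO
O10 2026-08-28 01:09Z: the THIRD kernel leg of the residual candidate's scope, after 'U_s ✗' («GrigorchukLamplighterCharacters») and 'N3 ✗' («…StandardGensNoGoHolds»
p592041)).  Helper file (`--supports stmt-CriticalPhenomena-4575 --as helper`).  Def-free.  On «GrigorchukLevelTransitive» (O10a: prefix preservation, infinitely many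
orbit points in every cylinder) and «GrigorchukLamplighterStandardGensNoGo» §1 (`right_mem_grigorchukGroup`, `tree_mem_wreathZ`).  NOTHING about growth; nothing about
`BenjaminiSchramm1996_conj4_endState`; `θ(p_c) = 0` on `Cay(ℤ ≀_X 𝔊; a, b, c, d, s)` stays NOT PROVED in the tree and not in print.
THE PROOF.  `π = (f, g) ∈ Γ₂`, `π ≠ 1`.  If the tree part `g ≠ 1`, it moves some ray `z`, hence (prefix preservation) every ray with the same prefix as `z` up to the
first moved letter — infinitely many points `y` of the orbit `X = 𝔊ρ`; the conjugates of `π` by the lamp letters at these `y` lie in pairwise distinct cosets of the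
centraliser (a commuting quotient would force `δ_{y′} − δ_y` to be `g`-invariant, impossible when `g` moves `y`).  If `g = 1`, the lamp configuration `f ≠ 0` has a
point `y` in its support; the orbit `𝔊 y` is infinite, and among the conjugates by the corresponding tree elements each coset of the centraliser occurs only
finitely often (a commuting quotient `k` fixes `f`, so maps `y` into the finite support).
* `wreathZ_index_centralizer_eq_zero (π ≠ 1) : (centralizer {π}).index = 0`; `wreathZ_not_finiteIndex_of_commuting`: no finite-index subgroup of `Γ₂` commutes with
  a non-trivial element — the covering route's `(z, N₀)` does not exist inside `Γ₂` (for ANY finite-index `Γ₀ ≤ Γ₂`, `wreathZ_no_fc_witness`).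
[cite: BartholdiErschler2012, §2 (W = Σ_X A ⋊ G), §3.1] [cite: MartineauSevero2019, §3 Remark 2] [cite: BenjaminiSchramm1996, §2 (Cayley graphs)]
-/

noncomputable section

namespace Summit.CriticalPhenomena.PercolationContinuityZ3.Theorems.Transplant

namespace Grigorchuk

open SemidirectProduct

/-- Distinct conjugates give distinct cosets of the centraliser: if `γ m`, `m : ℕ`, conjugate `π` to pairwise distinct elements then the centraliser of `π` has
infinite index. [folklore] -/
theorem index_centralizer_eq_zero_of_conj {G : Type} [Group G] (π : G) (γ : ℕ → G)
    (h : ∀ m m', (γ m)⁻¹ * γ m' ∈ Subgroup.centralizer ({π} : Set G) → m = m') : (Subgroup.centralizer ({π} : Set G)).index = 0 := by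
  rw [Subgroup.index_eq_zero_iff_infinite]
  exact Infinite.of_injective (fun m => (QuotientGroup.mk (γ m) : G ⧸ Subgroup.centralizer ({π} : Set G))) fun m m' hmm' =>
    h m m' (QuotientGroup.eq.1 hmm')

/-- The left (lamp) parts of a commutation `π δ = δ π` with a pure lamp `δ = inl H`: `f · (g·H) = H · f`, i.e. `g·H = H`. [folklore] -/
theorem lampAut_eq_of_commute {π : LampGroup ℤ} {H : Multiplicative (Ray →₀ ℤ)} (h : π * inl H = inl H * π) : lampAut ℤ π.right H = H := by
  have hl := congrArg SemidirectProduct.left h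
  rw [mul_left, left_inl, mul_left, left_inl, right_inl, map_one, MulAut.one_apply, mul_comm H] at hl
  exact mul_left_cancel hl

/-- **`Γ₂ = ℤ ≀_X 𝔊` has trivial FC-centre**: the centraliser of every `π ≠ 1` has infinite index (index `0`). [cite: BartholdiErschler2012, §2, §3.1] -/
theorem wreathZ_index_centralizer_eq_zero (π : ↥wreathZ) (hπ : π ≠ 1) : (Subgroup.centralizer ({π} : Set ↥wreathZ)).index = 0 := by
  classical
  set f : Multiplicative (Ray →₀ ℤ) := (π : LampGroup ℤ).left with hf
  set g : Equiv.Perm Ray := (π : LampGroup ℤ).right with hg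
  have hgG : g ∈ grigorchukGroup := right_mem_grigorchukGroup π.2
  by_cases hg1 : g = 1
  · /- CASE `g = 1`: `f ≠ 1`; conjugate by tree elements moving a point of the support of `f` -/
    have hf1 : Multiplicative.toAdd f ≠ 0 := by
      intro h0
      apply hπ
      refine Subtype.ext (SemidirectProduct.ext ?_ ?_)
      · rw [Subgroup.coe_one, one_left]; exact Multiplicative.toAdd.injective (by rw [← hf, h0, toAdd_one])
      · rw [Subgroup.coe_one, one_right, ← hg, hg1]
    obtain ⟨y, hy⟩ := Finsupp.support_nonempty_iff.2 hf1
    rw [Finsupp.mem_support_iff] at hy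
    obtain ⟨r, hrinj, hr⟩ := exists_orbit_seq y y 0
    choose k hk hky using fun m => (hr m).1
    -- conjugators: the tree elements `k m`
    let γ : ℕ → ↥wreathZ := fun m => ⟨tree (k m), tree_mem_wreathZ (hk m)⟩
    -- a commuting quotient `(k m)⁻¹ (k m')` fixes `f`, hence maps `y` into the support of `f`
    have hfib : ∀ m m', (γ m)⁻¹ * γ m' ∈ Subgroup.centralizer ({π} : Set ↥wreathZ) → (k m)⁻¹ (k m' y) ∈ (Multiplicative.toAdd f).support := by
      intro m m' hmm'
      have hc := (Subgroup.mem_centralizer_iff.1 hmm') π (Set.mem_singleton π)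
      have hc' : (π : LampGroup ℤ) * inr ((k m)⁻¹ * k m') = inr ((k m)⁻¹ * k m') * (π : LampGroup ℤ) := by
        have := congrArg (fun x : ↥wreathZ => (x : LampGroup ℤ)) hc
        simpa [γ, tree, map_mul, map_inv, mul_assoc] using this
      -- `π = inl f` (tree part trivial)
      have hπf : (π : LampGroup ℤ) = inl f := by
        rw [← inl_left_mul_inr_right (π : LampGroup ℤ), ← hg, hg1, map_one, mul_one]
      rw [hπf] at hc'
      -- `inl f * inr K = inr K * inl f` ⇒ `K·f = f`
      have hK : lampAut ℤ ((k m)⁻¹ * k m') f = f := by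
        have := congrArg SemidirectProduct.left hc'
        simp only [mul_left, left_inl, right_inl, map_one, left_inr, right_inr, one_mul, mul_one] at this
        exact this.symm
      have hK' : Finsupp.equivMapDomain ((k m)⁻¹ * k m') (Multiplicative.toAdd f) = Multiplicative.toAdd f := by
        rw [← toAdd_lampAut_apply, hK]
      have hval := congrArg (fun F : Ray →₀ ℤ => F (((k m)⁻¹ * k m') y)) hK'
      simp only [Finsupp.equivMapDomain_apply, Equiv.symm_apply_apply] at hval
      rw [Finsupp.mem_support_iff, show (k m)⁻¹ (k m' y) = ((k m)⁻¹ * k m') y from rfl, ← hval]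
      exact hy
    -- hence each coset is hit by finitely many `m`; infinitely many `m` ⇒ infinitely many cosets
    rw [Subgroup.index_eq_zero_iff_infinite]
    by_contra hfin
    rw [not_infinite_iff_finite] at hfin
    obtain ⟨q, hq⟩ := Finite.exists_infinite_fiber (fun m => (QuotientGroup.mk (γ m) : ↥wreathZ ⧸ Subgroup.centralizer ({π} : Set ↥wreathZ)))
    obtain ⟨⟨m₀, hm₀⟩⟩ := hq.nonempty
    -- the fibre injects into the finite set `(k m₀) '' support` via `m ↦ r m`
    have hinj : Function.Injective (fun m : ↥((fun m => (QuotientGroup.mk (γ m) : ↥wreathZ ⧸ Subgroup.centralizer ({π} : Set ↥wreathZ))) ⁻¹' {q}) =>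
        (⟨(k m₀)⁻¹ (k m y), hfib m₀ m (QuotientGroup.eq.1 (by
          have h1 : (QuotientGroup.mk (γ m₀) : ↥wreathZ ⧸ _) = q := hm₀
          have h2 : (QuotientGroup.mk (γ (m : ℕ)) : ↥wreathZ ⧸ _) = q := m.2
          rw [h1, h2]))⟩ : ↥(Multiplicative.toAdd f).support)) := by
      rintro ⟨m, hm⟩ ⟨m', hm'⟩ hmm'
      have h1 := congrArg (fun s : ↥(Multiplicative.toAdd f).support => (k m₀) (s : Ray)) hmm'
      simp only [Equiv.Perm.coe_inv, Equiv.apply_symm_apply] at h1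
      rw [hky, hky] at h1
      exact Subtype.ext (hrinj h1)
    haveI : Infinite ↥((fun m => (QuotientGroup.mk (γ m) : ↥wreathZ ⧸ Subgroup.centralizer ({π} : Set ↥wreathZ))) ⁻¹' {q}) := hq
    exact (Infinite.of_injective _ hinj).not_finite inferInstance
  · /- CASE `g ≠ 1`: conjugate by lamps at orbit points moved by `g` -/
    obtain ⟨z, hz⟩ : ∃ z : Ray, g z ≠ z := by
      by_contra h
      exact hg1 (Equiv.ext fun z => not_ne_iff.1 (not_exists.1 h z))
    obtain ⟨n₀, hn₀⟩ : ∃ n₀ : ℕ, g z n₀ ≠ z n₀ := by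
      by_contra h
      exact hz (funext fun i => not_ne_iff.1 (not_exists.1 h i))
    obtain ⟨r, hrinj, hr⟩ := exists_orbit_seq rho z (n₀ + 1)
    choose k hk hky using fun m => (hr m).1
    -- every `r m` is moved by `g`
    have hmove : ∀ m, g (r m) ≠ r m := by
      intro m h
      have h1 := apply_agree (n₀ + 1) hgG (x := r m) (y := z) (fun i hi => (hr m).2 i hi) n₀ (by omega)
      rw [h, (hr m).2 n₀ (by omega)] at h1
      exact hn₀ h1.symm
    -- conjugators: the lamp letters at `r m` (in `Γ₂` since `r m ∈ X`)
    have hγmem : ∀ m, (lamp (r m) 1 : LampGroup ℤ) ∈ wreathZ := by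
      intro m
      rw [← hky m, ← tree_mul_lamp_mul_tree_inv]
      exact wreathZ.mul_mem (wreathZ.mul_mem (tree_mem_wreathZ (hk m)) sW.2) (wreathZ.inv_mem (tree_mem_wreathZ (hk m)))
    let γ : ℕ → ↥wreathZ := fun m => ⟨lamp (r m) 1, hγmem m⟩
    refine index_centralizer_eq_zero_of_conj π γ fun m m' hmm' => ?_
    by_contra hne
    have hc := (Subgroup.mem_centralizer_iff.1 hmm') π (Set.mem_singleton π)
    have hc' : (π : LampGroup ℤ) * ((lamp (r m) 1)⁻¹ * lamp (r m') 1) = ((lamp (r m) 1)⁻¹ * lamp (r m') 1) * (π : LampGroup ℤ) := by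
      have := congrArg (fun x : ↥wreathZ => (x : LampGroup ℤ)) hc
      simpa [γ] using this
    -- the quotient of the two lamps is the pure lamp `H = δ_{r m'} − δ_{r m}`
    set H : Multiplicative (Ray →₀ ℤ) := Multiplicative.ofAdd (Finsupp.single (r m') (1 : ℤ) - Finsupp.single (r m) (1 : ℤ)) with hH
    have hq : ((lamp (r m) 1)⁻¹ * lamp (r m') 1 : LampGroup ℤ) = inl H := by
      rw [lamp, lamp, ← map_inv, ← map_mul, hH, sub_eq_neg_add, ofAdd_add, ofAdd_neg]
    rw [hq] at hc'
    have hinv := lampAut_eq_of_commute hc'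
    have hinv' : Finsupp.equivMapDomain g (Finsupp.single (r m') (1 : ℤ) - Finsupp.single (r m) 1) =
        Finsupp.single (r m') (1 : ℤ) - Finsupp.single (r m) 1 := by
      have := congrArg Multiplicative.toAdd hinv
      rwa [toAdd_lampAut_apply, hH, toAdd_ofAdd] at this
    -- evaluate at the point `g (r m)`: left side `−1`, right side `∈ {0, 1}`
    have hval := congrArg (fun F : Ray →₀ ℤ => F (g (r m))) hinv'
    simp only [Finsupp.equivMapDomain_apply, Finsupp.coe_sub, Pi.sub_apply, Finsupp.single_apply] at hval
    have e1 : (g.symm (g (r m))) = r m := g.symm_apply_apply (r m)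
    rw [e1] at hval
    have hne1 : r m' ≠ r m := fun h => hne (hrinj h).symm
    have hne2 : r m ≠ g (r m) := fun h => hmove m h.symm
    rw [if_neg hne1, if_pos rfl, if_neg hne2] at hval
    by_cases h3 : r m' = g (r m)
    · rw [if_pos h3] at hval; omega
    · rw [if_neg h3] at hval; omega

/-- **No finite-index subgroup of `Γ₂` commutes with a non-trivial element** (FC(Γ₂) = 1). [cite: BartholdiErschler2012, §2, §3.1] -/
theorem wreathZ_not_finiteIndex_of_commuting (π : ↥wreathZ) (hπ : π ≠ 1) (N : Subgroup ↥wreathZ) (hN : ∀ n ∈ N, n * π = π * n) : ¬ N.FiniteIndex := by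
  intro hfi
  have hle : N ≤ Subgroup.centralizer ({π} : Set ↥wreathZ) := fun n hn =>
    Subgroup.mem_centralizer_iff.2 fun h hh => by rw [Set.mem_singleton_iff.1 hh]; exact (hN n hn).symm
  haveI : (Subgroup.centralizer ({π} : Set ↥wreathZ)).FiniteIndex := Subgroup.finiteIndex_of_le hle
  exact Subgroup.FiniteIndex.index_ne_zero (wreathZ_index_centralizer_eq_zero π hπ)

/-- **The covering route has no input inside `Γ₂`**: for every finite-index `Γ₀ ≤ Γ₂`, no `z ∈ Γ₀` with `z ≠ 1` commutes with a finite-index subgroup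
`N₀ ≤ Γ₀` — in particular the witness `(z, N₀)` of `EndStateCayley.criticalContinuity_of_vfc` (a `z` with a non-trivial character value and a finite-index `N₀`
commuting with it) does not exist for `Γ = Γ₂`. [cite: MartineauSevero2019, §3 Remark 2] [cite: BenjaminiSchramm1996, §2 (Cayley graphs)] -/
theorem wreathZ_no_fc_witness (Γ₀ : Subgroup ↥wreathZ) [Γ₀.FiniteIndex] (z : ↥Γ₀) (hz : z ≠ 1) (N₀ : Subgroup ↥Γ₀) [N₀.FiniteIndex]
    (hN₀ : ∀ n ∈ N₀, n * z = z * n) : False := by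
  have hz' : (z : ↥wreathZ) ≠ 1 := fun h => hz (Subtype.ext (by exact_mod_cast h))
  refine wreathZ_not_finiteIndex_of_commuting (z : ↥wreathZ) hz' (N₀.map Γ₀.subtype) ?_ ⟨?_⟩
  · rintro n ⟨n₀, hn₀, rfl⟩
    have := congrArg (fun x : ↥Γ₀ => (x : ↥wreathZ)) (hN₀ n₀ hn₀)
    simpa using this
  · rw [Subgroup.index_map_subtype]
    exact Nat.mul_ne_zero Subgroup.FiniteIndex.index_ne_zero Subgroup.FiniteIndex.index_ne_zero

end Grigorchuk

end Summit.CriticalPhenomena.PercolationContinuityZ3.Theorems.Transplant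

end
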